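import Literature.Topology.FourManifolds.HomotopySpheres
import Literature.Geometry.Symplectic.StandardEnd
import Literature.Geometry.Kaehler.ManifoldFormsChart
import Literature.Geometry.Kaehler.ManifoldFormsPullback
import Literature.Geometry.Kaehler.PullbackFamilyChart
import Literature.Analysis.FunctionSpaces.ParametricIntegralSmooth
import Mathlib.MeasureTheory.Integral.Bochner.ContinuousLinearMap
import Mathlib.MeasureTheory.Integral.Bochner.Basic
import Mathlib.MeasureTheory.Function.LocallyIntegrable
import Mathlib.MeasureTheory.Measure.OpenPos
import Mathlib.MeasureTheory.Measure.Haar.InnerProductSpace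
import Mathlib.Geometry.Manifold.ContMDiffMFDeriv
import Mathlib.Analysis.SpecialFunctions.SmoothTransition
import Mathlib.Analysis.Calculus.BumpFunction.FiniteDimension

/-!
# Helper `helper_croftonPositivity` of stub `stub_croftonTaming`

Line `crofton-pencil-laminar-charge`, crux `SullivanDual.Target` (stmt-SmoothPoincare4-7823),
skeleton v2 (`Cruxes/Target/Lines/crofton_pencil_laminar_charge.lean`).

**Pointwise positivity of the Crofton taming form.** On the punctured homotopy `4`-sphere
`punctured p` we are given, for each sheet `σ : Bool`, a jointly smooth family of intercept maps
`Φ σ : ℂ → punctured p → ℂ` (direction `a`, point `x`), a field of endomorphisms `J`, a radius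
`R₀` and a continuous weight `ρ ≥ 0` on `ℂ × ℂ`, positive on `{‖a‖ < 2, ‖b‖ < R₀ + 1}` and
vanishing for `‖a‖ ≥ 3`. Writing `L = mfderiv (𝓡 4) 𝓘(ℝ, ℂ) (Φ σ a) x` and
`dA(α, β) = Re α Im β − Im α Re β`, the Crofton form is
`sf x (v, w) = Σ_σ ∫ ρ(a, Φ σ a x) · dA(L v, L w) da`. We prove `sf x (v, J v) > 0` for `v ≠ 0`
from: (Q2) `L v ≠ 0 ⇒ dA(L v, L (J v)) > 0`; (Q3) for fixed `σ, x` and `v ≠ 0` at most one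
direction `a` has `L v = 0`; (Q4) some `(σ, a)` with `‖a‖ ≤ 1`, `‖Φ σ a x‖ ≤ R₀`.

Proof. Fix `x`, `v ≠ 0`; let `g σ a` be the integrand. (1) `g σ ≥ 0`: if `L v = 0` the `dA`
factor vanishes, otherwise (Q2) and `ρ ≥ 0`. (2) `g σ` is continuous in `a`: `a ↦ Φ σ a x` is
continuous, and `a ↦ mfderiv (𝓡 4) 𝓘(ℝ, ℂ) (Φ σ a) x` is continuous by Mathlib's
`ContMDiffAt.mfderiv` (smooth dependence of the partial derivative of a jointly smooth family on
the parameter) — since the base point is constant and the target is a vector space, the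
`inTangentCoordinates` of that lemma reduce to `mfderiv` itself
(`continuous_mfderiv_family`). (3) `g σ` vanishes for `‖a‖ ≥ 3`, hence is compactly supported
and integrable, and `0 ≤ ∫ g σ`. (4) From (Q4) get `σ₀, a₀` with `ρ(a₀, Φ σ₀ a₀ x) > 0`; by
continuity `ρ(a, Φ σ₀ a x) > 0` on a ball around `a₀`; by (Q3) one of the two points
`a₀, a₀ + δ/2` of that ball has `L v ≠ 0`, so `g σ₀ > 0` somewhere, and a continuous nonnegative
integrable function positive somewhere has positive integral (`integral_pos_of_nonneg_of_pos`:
its open positivity set has positive Lebesgue measure). (5) Add the nonnegative other integral.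
-/

noncomputable section

-- the prescribed namespace `Summit.<P>.<Sub>.…` duplicates `SmoothPoincare4` (P = Sub)
set_option linter.dupNamespace false

open scoped Manifold ContDiff Topology
open Set Filter MeasureTheory Literature.Geometry.Kaehler Literature.Geometry.Symplectic
  Literature.Topology.FourManifolds

namespace Summit.SmoothPoincare4.SmoothPoincare4.Theorems.Target.CroftonPencil

section Family

-- The identification `TangentSpace I x = E` is an abuse of definitional equality; as in Mathlib's
-- tangent-bundle files we let `isDefEq` unfold it.
set_option backward.isDefEq.respectTransparency false

/-- **Continuity in the parameter of the slice derivative of a jointly smooth family.** For a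
family `Ψ : P → M → F'` from a normed space into a normed space, jointly `C^∞` on `P × M`, a point
`x : M` and a vector `v`, the map `a ↦ mfderiv I 𝓘(ℝ, F') (Ψ a) x v` is continuous. This is
Mathlib's `ContMDiffAt.mfderiv` with the constant base point `g = fun _ ↦ x`: the coordinate
changes in `inTangentCoordinates` are then the identity (same chart at `x` on the source side,
model vector space on the target side). -/
theorem continuous_mfderiv_family
    {EM : Type*} [NormedAddCommGroup EM] [NormedSpace ℝ EM] {HM : Type*} [TopologicalSpace HM]
    {I : ModelWithCorners ℝ EM HM} {M : Type*} [TopologicalSpace M] [ChartedSpace HM M]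
    [IsManifold I 1 M]
    {P : Type*} [NormedAddCommGroup P] [NormedSpace ℝ P]
    {F' : Type*} [NormedAddCommGroup F'] [NormedSpace ℝ F']
    {Ψ : P → M → F'} (hΨ : ContMDiff (𝓘(ℝ, P).prod I) 𝓘(ℝ, F') ∞ (Function.uncurry Ψ))
    (x : M) (v : EM) :
    Continuous fun a : P => (mfderiv I 𝓘(ℝ, F') (Ψ a) x v : F') := by
  -- continuity of `a ↦ mfderiv (Ψ a) x` as a map into `EM →L[ℝ] F'`
  have hL : Continuous (X := P) (Y := EM →L[ℝ] F') fun a => mfderiv I 𝓘(ℝ, F') (Ψ a) x := by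
    refine continuous_iff_continuousAt.2 fun a₀ => ?_
    have hf : ContMDiffAt (𝓘(ℝ, P).prod I) 𝓘(ℝ, F') ∞ (Function.uncurry Ψ)
        (a₀, (fun _ : P => x) a₀) := hΨ.contMDiffAt
    have hg : ContMDiffAt 𝓘(ℝ, P) I 0 (fun _ : P => x) a₀ := contMDiffAt_const
    have h := (hf.mfderiv Ψ (fun _ : P => x) hg (by simp)).continuousAt
    refine h.congr (Eventually.of_forall fun a => ?_)
    -- the coordinate changes in `inTangentCoordinates` are trivial here
    ext w
    rw [inTangentCoordinates_eq (I := I) (I' := 𝓘(ℝ, F')) (fun _ : P => x) (fun a => Ψ a x)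
      (fun a => mfderiv I 𝓘(ℝ, F') (Ψ a) x) (x₀ := a₀) (x := a) (mem_chart_source HM x) (by simp)]
    simp only [ContinuousLinearMap.coe_comp, Function.comp_apply,
      tangentBundleCore_coordChange_model_space, ContinuousLinearMap.id_apply]
    rw [(tangentBundleCore I M).coordChange_self (achart HM x) x (by simp) w]
  have h2 := Continuous.clm_apply (E := EM) (F := F') hL (continuous_const (y := v))
  exact h2

end Family

/-- **A continuous nonnegative function on `ℂ` vanishing outside the disc of radius `3` and
positive somewhere has positive integral**: it is compactly supported hence integrable, and its
support contains the nonempty open set `{g > 0}`, of positive Lebesgue measure. -/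
theorem integral_pos_of_nonneg_of_pos {g : ℂ → ℝ} (hg : Continuous g) (h0 : ∀ a, 0 ≤ g a)
    (h3 : ∀ a : ℂ, 3 ≤ ‖a‖ → g a = 0) {a₁ : ℂ} (ha₁ : 0 < g a₁) : 0 < ∫ a, g a := by
  have hsupp : HasCompactSupport g :=
    HasCompactSupport.intro (isCompact_closedBall (0 : ℂ) 3)
      fun a ha => h3 a (by simpa using ha : 3 < ‖a‖).le
  have hint : Integrable g := hg.integrable_of_hasCompactSupport hsupp
  rw [integral_pos_iff_support_of_nonneg (fun a => h0 a) hint]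
  have hopen : IsOpen {a : ℂ | 0 < g a} := isOpen_lt continuous_const hg
  have hsub : {a : ℂ | 0 < g a} ⊆ Function.support g := fun a ha => (ne_of_gt ha : g a ≠ 0)
  exact lt_of_lt_of_le (hopen.measure_pos volume ⟨a₁, ha₁⟩) (measure_mono hsub)

/-- **Registered helper `helper_croftonPositivity`** (signature registered verbatim on
stmt-SmoothPoincare4-7823): pointwise positivity `sf x (v, J v) > 0` (`v ≠ 0`) of the Crofton
taming form `sf x (v, w) = Σ_σ ∫ ρ(a, Φ σ a x) · dA(L v, L w) da`,
`L = mfderiv (𝓡 4) 𝓘(ℝ, ℂ) (Φ σ a) x`, from joint smoothness of the intercept families (Q1),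
positivity of `dA(L v, L (J v))` on `L v ≠ 0` (Q2), transversality of the pencils (Q3), the
existence of a charged member (Q4), and a continuous weight `ρ ≥ 0`, positive on
`{‖a‖ < 2, ‖b‖ < R₀ + 1}`, vanishing for `‖a‖ ≥ 3`. See the module docstring for the proof. -/
theorem helper_croftonPositivity :
    ∀ (S : HomotopySphere 4) (p : S.carrier)
      (J : ∀ x : punctured p, TangentSpace (𝓡 4) x →L[ℝ] TangentSpace (𝓡 4) x)
      (Φ : Bool → ℂ → punctured p → ℂ) (R₀ : ℝ) (ρ : ℂ × ℂ → ℝ),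
      (∀ σ, ContMDiff (𝓘(ℝ, ℂ).prod (𝓡 4)) 𝓘(ℝ, ℂ) ∞ (Function.uncurry (Φ σ))) →
      (∀ σ (a : ℂ) (x : punctured p) (v : TangentSpace (𝓡 4) x),
        mfderiv (𝓡 4) 𝓘(ℝ, ℂ) (Φ σ a) x v ≠ 0 →
        0 < (mfderiv (𝓡 4) 𝓘(ℝ, ℂ) (Φ σ a) x v).re * (mfderiv (𝓡 4) 𝓘(ℝ, ℂ) (Φ σ a) x (J x v)).im
            - (mfderiv (𝓡 4) 𝓘(ℝ, ℂ) (Φ σ a) x v).im * (mfderiv (𝓡 4) 𝓘(ℝ, ℂ) (Φ σ a) x (J x v)).re) →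
      (∀ σ (x : punctured p) (v : TangentSpace (𝓡 4) x) (a a' : ℂ), v ≠ 0 →
        mfderiv (𝓡 4) 𝓘(ℝ, ℂ) (Φ σ a) x v = 0 → mfderiv (𝓡 4) 𝓘(ℝ, ℂ) (Φ σ a') x v = 0 → a = a') →
      (∀ x : punctured p, ∃ (σ : Bool) (a : ℂ), ‖a‖ ≤ 1 ∧ ‖Φ σ a x‖ ≤ R₀) →
      Continuous ρ → (∀ q, 0 ≤ ρ q) →
      (∀ q : ℂ × ℂ, ‖q.1‖ < 2 → ‖q.2‖ < R₀ + 1 → 0 < ρ q) →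
      (∀ q : ℂ × ℂ, 3 ≤ ‖q.1‖ → ρ q = 0) →
      ∀ (x : punctured p) (v : TangentSpace (𝓡 4) x), v ≠ 0 →
        0 < (∫ a, ρ (a, Φ false a x) *
              ((mfderiv (𝓡 4) 𝓘(ℝ, ℂ) (Φ false a) x v).re * (mfderiv (𝓡 4) 𝓘(ℝ, ℂ) (Φ false a) x (J x v)).im
                - (mfderiv (𝓡 4) 𝓘(ℝ, ℂ) (Φ false a) x v).im * (mfderiv (𝓡 4) 𝓘(ℝ, ℂ) (Φ false a) x (J x v)).re))
          + (∫ a, ρ (a, Φ true a x) *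
              ((mfderiv (𝓡 4) 𝓘(ℝ, ℂ) (Φ true a) x v).re * (mfderiv (𝓡 4) 𝓘(ℝ, ℂ) (Φ true a) x (J x v)).im
                - (mfderiv (𝓡 4) 𝓘(ℝ, ℂ) (Φ true a) x v).im * (mfderiv (𝓡 4) 𝓘(ℝ, ℂ) (Φ true a) x (J x v)).re)) := by
  intro S p J Φ R₀ ρ hΦ hQ2 hQ3 hQ4 hρc hρ0 hρpos hρ3 x v hv
  -- the integrands, one for each sheet
  set g : Bool → ℂ → ℝ := fun σ a => ρ (a, Φ σ a x) *
      ((mfderiv (𝓡 4) 𝓘(ℝ, ℂ) (Φ σ a) x v).re * (mfderiv (𝓡 4) 𝓘(ℝ, ℂ) (Φ σ a) x (J x v)).im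
        - (mfderiv (𝓡 4) 𝓘(ℝ, ℂ) (Φ σ a) x v).im * (mfderiv (𝓡 4) 𝓘(ℝ, ℂ) (Φ σ a) x (J x v)).re)
    with hg
  change 0 < (∫ a, g false a) + ∫ a, g true a
  -- (2) continuity in the direction `a`
  have hΦx : ∀ σ, Continuous fun a : ℂ => Φ σ a x := fun σ =>
    (hΦ σ).continuous.comp (continuous_id.prodMk continuous_const)
  have hcont : ∀ σ, Continuous (g σ) := by
    intro σ
    have h2 : Continuous fun a : ℂ => (mfderiv (𝓡 4) 𝓘(ℝ, ℂ) (Φ σ a) x v : ℂ) :=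
      continuous_mfderiv_family (hΦ σ) x v
    have h3 : Continuous fun a : ℂ => (mfderiv (𝓡 4) 𝓘(ℝ, ℂ) (Φ σ a) x (J x v) : ℂ) :=
      continuous_mfderiv_family (hΦ σ) x (J x v)
    have h2re : Continuous fun a : ℂ => (mfderiv (𝓡 4) 𝓘(ℝ, ℂ) (Φ σ a) x v).re :=
      Complex.continuous_re.comp h2
    have h2im : Continuous fun a : ℂ => (mfderiv (𝓡 4) 𝓘(ℝ, ℂ) (Φ σ a) x v).im :=
      Complex.continuous_im.comp h2
    have h3re : Continuous fun a : ℂ => (mfderiv (𝓡 4) 𝓘(ℝ, ℂ) (Φ σ a) x (J x v)).re :=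
      Complex.continuous_re.comp h3
    have h3im : Continuous fun a : ℂ => (mfderiv (𝓡 4) 𝓘(ℝ, ℂ) (Φ σ a) x (J x v)).im :=
      Complex.continuous_im.comp h3
    have hρa : Continuous fun a : ℂ => ρ (a, Φ σ a x) :=
      hρc.comp (continuous_id.prodMk (hΦx σ))
    exact hρa.mul ((h2re.mul h3im).sub (h2im.mul h3re))
  -- (1) nonnegativity
  have hnn : ∀ σ a, 0 ≤ g σ a := by
    intro σ a
    by_cases h : mfderiv (𝓡 4) 𝓘(ℝ, ℂ) (Φ σ a) x v = 0
    · -- the `dA` factor vanishes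
      have h' : (mfderiv (𝓡 4) 𝓘(ℝ, ℂ) (Φ σ a) x v : ℂ) = (0 : ℂ) := h
      simp [hg, h']
    · exact mul_nonneg (hρ0 _) (hQ2 σ a x v h).le
  -- (3) vanishing for `‖a‖ ≥ 3`, nonnegativity of the integrals
  have hvan : ∀ σ (a : ℂ), 3 ≤ ‖a‖ → g σ a = 0 := fun σ a ha => by
    simp [hg, hρ3 (a, Φ σ a x) ha]
  have hInn : ∀ σ, 0 ≤ ∫ a, g σ a := fun σ => integral_nonneg (hnn σ)
  -- (4) a sheet and a direction where the integrand is positive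
  obtain ⟨σ₀, a₀, ha₀, hb₀⟩ := hQ4 x
  obtain ⟨a₁, ha₁⟩ : ∃ a₁, 0 < g σ₀ a₁ := by
    have hU : IsOpen {a : ℂ | 0 < ρ (a, Φ σ₀ a x)} :=
      isOpen_lt continuous_const (hρc.comp (continuous_id.prodMk (hΦx σ₀)))
    have hρa₀ : 0 < ρ (a₀, Φ σ₀ a₀ x) :=
      hρpos (a₀, Φ σ₀ a₀ x) (lt_of_le_of_lt ha₀ one_lt_two) (lt_of_le_of_lt hb₀ (lt_add_one R₀))
    obtain ⟨δ, hδ, hball⟩ := Metric.isOpen_iff.1 hU a₀ hρa₀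
    have hmem : a₀ + ((δ / 2 : ℝ) : ℂ) ∈ Metric.ball a₀ δ := by
      rw [Metric.mem_ball, dist_eq_norm, add_sub_cancel_left, Complex.norm_real, Real.norm_eq_abs,
        abs_of_pos (half_pos hδ)]
      exact half_lt_self hδ
    have hne : a₀ + ((δ / 2 : ℝ) : ℂ) ≠ a₀ := by
      intro h
      have h' : (δ / 2 : ℝ) = 0 := Complex.ofReal_eq_zero.mp (add_eq_left.mp h)
      linarith
    by_cases hL0 : mfderiv (𝓡 4) 𝓘(ℝ, ℂ) (Φ σ₀ a₀) x v = 0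
    · by_cases hL1 : mfderiv (𝓡 4) 𝓘(ℝ, ℂ) (Φ σ₀ (a₀ + ((δ / 2 : ℝ) : ℂ))) x v = 0
      · exact absurd (hQ3 σ₀ x v _ _ hv hL1 hL0) hne
      · exact ⟨_, mul_pos (hball hmem) (hQ2 σ₀ _ x v hL1)⟩
    · exact ⟨a₀, mul_pos hρa₀ (hQ2 σ₀ a₀ x v hL0)⟩
  have hpos : 0 < ∫ a, g σ₀ a := integral_pos_of_nonneg_of_pos (hcont σ₀) (hnn σ₀) (hvan σ₀) ha₁
  -- (5) conclude by cases on the positive sheet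
  cases σ₀ with
  | false => exact add_pos_of_pos_of_nonneg hpos (hInn true)
  | true => exact add_pos_of_nonneg_of_pos (hInn false) hpos

end Summit.SmoothPoincare4.SmoothPoincare4.Theorems.Target.CroftonPencil

end
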